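import Summits.HubbardSuperconductivity.HubbardSuperconductivity.Theorems.AnisotropyChordInsertionEntropyGroundStateFloor

/-!
# Route `AnisotropyChord` / H0 rotor rung: TELEPORTATION DECONFINEMENT OF THE GROUND STATES ⇒ ODLRO
# (theory seat `hubbard-h0-rotor-theory-1`, cycle 9, memo ROTOR-THEORY-9 §136 (e), (l)) — H0-T at the Hamiltonian level

The theory seat typed the conclusion side of H0 as `TeleDeconfined` for an explicitly given FAMILY of amplitudes
(tree `…InsertionEntropyTeleDeconfinement`).  Here it is specialised to the Hamiltonian's own Perron sector ground
amplitudes and linked to the tree's `EventualCondensate`: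

* `GroundStateTeleDeconfined Δ M` — `∃ K, ∀ᶠ L, T(a_L) ≥ −K` for the Perron amplitudes of the sectors `M L`
  (typed; the WEAKEST entropic hypothesis of the file family): `groundStateTeleDeconfined_of_teleEntropyBound`
  (H1‴ ⇒ it, via tree `meanTeleLog_ge_of_klDiv_le`);
* **`eventualCondensate_of_groundStateTeleDeconfined`** : `ρ_L → ρ ∈ (0,1) → GroundStateTeleDeconfined Δ M →
  EventualCondensate Δ M` (the unconditional floor `condensateDensity_ge_exp_meanTeleLog_of_isPerron` of the companion
  file `…GroundStateFloor`), and in the route's order-parameter currency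
  **`eventual_lambda_ge_of_groundStateTeleDeconfined`** : `… → ∃ c > 0, ∀ᶠ L, ∀` normalised sector-`M_L` ground
  states `ψ`, `c·L⁴ ≤ Re⟨ψ, S⁺_tot S⁻_tot ψ⟩` (tree `Stiffness.eventual_lambda_ge_of_eventualCondensate`).

So the tree's end-to-end statement «(S_Υ)+(K)+(H1′) ⇒ BEC» (`…StiffnessCompressibility`) has the companion
«`GroundStateTeleDeconfined` ⇒ BEC» in which the Gaussian comparison H1′ is replaced by the averaged log-cost floor of
memo §136 (l); the open arrow of H0 is «(S)+(K) ⇒ `GroundStateTeleDeconfined`».  Nothing here claims it.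
-/

set_option linter.dupNamespace false

noncomputable section

open Matrix Complex Finset Filter Topology
open Literature.MathematicalPhysics.QuantumLattice hiding torusPhase torusNorm
open Literature.Probability.LatticeModels

namespace Summit.HubbardSuperconductivity.HubbardSuperconductivity.Theorems.AnisotropyChord.InsertionEntropy

section GroundStateDeconfinement

/-- **H0-T AT THE HAMILTONIAN LEVEL — `GroundStateTeleDeconfined Δ M` (typed; OPEN as a consequence of (S)+(K)).**
Along the sector sequence `M L` there is `K` such that, eventually in `L`, every Perron sector ground amplitude `a` of
`H(Δ) = xxzHamiltonian 1 (torusGraph 2 L) (−1) Δ` in the sector `M L` has mean teleportation log-ratio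
`meanTeleLog a (L²/2 + M L) ≥ −K` («the teleported particle–hole pair is deconfined»).  This is the theory seat's
`TeleDeconfined` (typed for explicit families of amplitudes) specialised to the Hamiltonian's own ground states; it is
implied by H1‴ `TeleEntropyBound` (`groundStateTeleDeconfined_of_teleEntropyBound`) and is therefore the weakest
entropic hypothesis in the file family that still gives `EventualCondensate`.  Conjecture H0 in this currency:
uniform transverse stiffness + bounded compressibility ⇒ `GroundStateTeleDeconfined`.
[conjecture: theory seat hubbard-h0-rotor-theory-1, cycle 9, 2026-08-28 — memo ROTOR-THEORY-9 §136 (e), (l)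
(H0-T, Hamiltonian-level form; typed by the prover seat on the theory seat's instruction «restate the end-to-end theorem
with a TeleDeconfined-type hypothesis»; OPEN)] -/
def GroundStateTeleDeconfined (Δ : ℝ) (M : ℕ → ℝ) : Prop :=
  ∃ K : ℝ, ∀ᶠ L : ℕ in atTop, ∀ [NeZero L], ∀ aN : TensorIndex (TorusSite 2 L) 2 → ℝ,
    IsPerronSectorGroundAmplitude L Δ (M L) aN → -K ≤ meanTeleLog aN ((L : ℝ) ^ 2 / 2 + M L)

/-- **H1‴ ⇒ H0-T:** a uniform per-pair teleportation-entropy bound (`TeleEntropyBound`, tree …OneStateSkeleton) gives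
`GroundStateTeleDeconfined` with the same constant (tree `meanTeleLog_ge_of_klDiv_le`; Perron–Frobenius supplies the
support hypotheses).  So the hypothesis of this file is weaker than every entropic crux typed so far
(E ⇒ … , H1′ ⇒ H1‴ ⇒ H0-T). [folklore] -/
theorem groundStateTeleDeconfined_of_teleEntropyBound (Δ : ℝ) (M : ℕ → ℝ) (hT : TeleEntropyBound Δ M) :
    GroundStateTeleDeconfined Δ M := by
  obtain ⟨K, hK⟩ := hT
  refine ⟨max K 0, ?_⟩
  filter_upwards [hK] with L hKL
  intro _ aN ha
  have hcard : (Fintype.card (TorusSite 2 L) : ℝ) = (L : ℝ) ^ 2 := by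
    rw [Fintype.card_fun, ZMod.card, Fintype.card_fin]; push_cast; ring
  have hsect : ∀ σ, aN σ ≠ 0 → ((univ.filter fun z => σ z = 0).card : ℝ) = (L : ℝ) ^ 2 / 2 + M L := by
    intro σ hσ
    rw [← hcard]
    exact card_filter_eq_zero_of_mem_sector ha.sector (by exact_mod_cast hσ : (aN σ : ℂ) ≠ 0)
  exact meanTeleLog_ge_of_klDiv_le aN _ (max K 0) (le_max_right K 0) ha.nonneg ha.unit hsect
    (pairMass_symm_of_siteDensity aN _ (fun x => siteDensity_eq_of_isPerron L Δ (M L) aN ha x))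
    (fun σ u v _ _ _ hσ => perronAmplitude_move_pos Δ (M L) aN ha σ u v hσ)
    (fun x y hxy => ((hKL aN ha x y hxy).2).trans (le_max_left K 0))

/-- **LAYER 1 OF H0 IN THE TREE'S CURRENCY (PROVED LINK): `GroundStateTeleDeconfined` ⇒ `EventualCondensate`.**
Along `ρ_L = 1/2 + M_L/L² → ρ ∈ (0,1)`, deconfinement `T ≥ −K` of the Perron ground amplitudes gives the uniform
condensate floor `(ρ/2)((1−ρ)/2)·e^{−K/2}`. Theory seat memo ROTOR-THEORY-9 §136 (e), (l). [folklore] -/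
theorem eventualCondensate_of_groundStateTeleDeconfined (Δ : ℝ) (M : ℕ → ℝ) (ρ : ℝ)
    (hρ : ρ ∈ Set.Ioo (0 : ℝ) 1)
    (hlim : Tendsto (fun L : ℕ => 1 / 2 + M L / (L : ℝ) ^ 2) atTop (𝓝 ρ))
    (hT : GroundStateTeleDeconfined Δ M) :
    EventualCondensate Δ M := by
  obtain ⟨K, hK⟩ := hT
  have hρ0 : 0 < ρ := hρ.1
  have hρ1 : ρ < 1 := hρ.2
  have hlow : ∀ᶠ L : ℕ in atTop, ρ / 2 ≤ 1 / 2 + M L / (L : ℝ) ^ 2 :=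
    hlim.eventually (eventually_ge_nhds (by linarith : ρ / 2 < ρ))
  have hup : ∀ᶠ L : ℕ in atTop, 1 / 2 + M L / (L : ℝ) ^ 2 ≤ (1 + ρ) / 2 :=
    hlim.eventually (eventually_le_nhds (by linarith : ρ < (1 + ρ) / 2))
  refine ⟨ρ / 2 * ((1 - ρ) / 2) * Real.exp (-K / 2), by
    have : 0 < 1 - ρ := by linarith
    positivity, ?_⟩
  filter_upwards [hK, hlow, hup] with L hKL hlo hhi
  intro _ aN haN
  have main := condensateDensity_ge_exp_meanTeleLog_of_isPerron L Δ (M L) aN haN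
  refine le_trans ?_ main
  have h1 : ρ / 2 * ((1 - ρ) / 2) ≤ (1 / 2 + M L / (L : ℝ) ^ 2) * (1 - (1 / 2 + M L / (L : ℝ) ^ 2)) := by
    apply mul_le_mul hlo (by linarith) (by linarith) (le_trans (by linarith) hlo)
  have h2 : Real.exp (-K / 2) ≤ Real.exp (meanTeleLog aN ((L : ℝ) ^ 2 / 2 + M L) / 2) :=
    Real.exp_le_exp.mpr (by linarith [hKL aN haN])
  have h3 : 0 ≤ (1 / 2 + M L / (L : ℝ) ^ 2) * (1 - (1 / 2 + M L / (L : ℝ) ^ 2)) :=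
    le_trans (by have : 0 < 1 - ρ := by linarith
                 positivity) h1
  exact mul_le_mul h1 h2 (le_of_lt (Real.exp_pos _)) h3

/-- **The same link in the ROUTE'S ORDER-PARAMETER CURRENCY** (`Λ(ψ) = Re⟨ψ, S⁺_tot S⁻_tot ψ⟩`, the quantity bounded in
`FerroSideChord` / `ChordFM`): along `ρ_L → ρ ∈ (0,1)`, `GroundStateTeleDeconfined Δ M` gives `∃ c > 0` such that,
eventually in `L`, every normalised sector-`M_L` ground state `ψ` of `H(Δ)` has `c·L⁴ ≤ Re⟨ψ, (Σ_x S⁺_x)(Σ_y S⁻_y) ψ⟩`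
(tree `Stiffness.eventual_lambda_ge_of_eventualCondensate`). [folklore] -/
theorem eventual_lambda_ge_of_groundStateTeleDeconfined (Δ : ℝ) (M : ℕ → ℝ) (ρ : ℝ)
    (hρ : ρ ∈ Set.Ioo (0 : ℝ) 1)
    (hlim : Tendsto (fun L : ℕ => 1 / 2 + M L / (L : ℝ) ^ 2) atTop (𝓝 ρ))
    (hT : GroundStateTeleDeconfined Δ M) :
    ∃ c > (0 : ℝ), ∀ᶠ L : ℕ in atTop, ∀ [NeZero L], ∀ ψ : TensorIndex (TorusSite 2 L) 2 → ℂ,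
      ψ ∈ spinZSector (Λ := TorusSite 2 L) 1 (M L) → star ψ ⬝ᵥ ψ = 1 →
        Stiffness.hcbHamiltonian L Δ *ᵥ ψ
            = ((lowestEnergyInSector 1 (Stiffness.hcbHamiltonian L Δ) (M L) : ℝ) : ℂ) • ψ →
          c * (L : ℝ) ^ 4 ≤ (star ψ ⬝ᵥ (((∑ x : TorusSite 2 L, onSite x (spinRaise 1))
              * (∑ y : TorusSite 2 L, onSite y (spinLower 1)) : Op (TorusSite 2 L) 2) *ᵥ ψ)).re :=
  Stiffness.eventual_lambda_ge_of_eventualCondensate Δ M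
    (eventualCondensate_of_groundStateTeleDeconfined Δ M ρ hρ hlim hT)

end GroundStateDeconfinement

end Summit.HubbardSuperconductivity.HubbardSuperconductivity.Theorems.AnisotropyChord.InsertionEntropy
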